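import Summits.Ventures.YMGap.RobustBall.BoundaryStateMarginal
import Summits.Ventures.YMGap.RobustBall.BoundaryEntropyDensity
import Summits.Ventures.YMGap.RobustBall.BoundaryFreeEnergyVanHoveDim
import HarnessLib

/-!
# Venture YMGap, track ROBUST-BALL — «C-ENT-μ» FOR EVERY `SU(N)` AND EVERY `d ≥ 2`: the relative entropy of THE DLR state's marginal on a finite
# region is volume × density ± surface, and its specific entropy exists along every van Hove sequence, on the 't Hooft single-link window

HONEST FRAMING. WHAT THIS IS: a venture file (cell `pub-ymgap`, track Y2 ROBUST-BALL / DS, seat ds-3, theorems only, 0 compute): the every-`N`,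
every-`d` twins of `BoundaryStateEntropy` (which is `SU(2)`, `d = 4`, star window). Window: `0 ≤ β ≤ 1/(12(d−1))`, `β < 1/(8d)`, tree coupling `Nβ`,
ratio `r = max(ρ,½)` with `6(d−1)β/(½ − 2(d−1)β) ≤ ρ < 1`, `C_N = 32N⁴√N`; depths `D_p ≤ ‖y − z‖_∞` (links `y` of `p`, `z ∉ Λ`); `μ` THE DLR state at
`Nβ` (unique, axis symmetric), `u = μ(Re tr U_{p₀})`, `#planes(d) = d(d−1)/2`, `μ|_Λ` the marginal on the links of `Λ`, `∂T(Λ) = {p ∈ T(Λ) : p ⊄ Λ}`: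
* ★★ `suN_abs_klDiv_state_restrict_sub_le_dim` —
  `|KL(μ|_Λ ‖ Haar_Λ) − #T(Λ)·(−Nβ(N − u) − f(Nβ)/#planes(d))| ≤ 2Nβ·Σ_{p∈T(Λ)} min (2N) (C_N r^{⌊D_p⌋}) + 2N·Nβ·#∂T(Λ)` — HYPOTHESIS-FREE;
* ★★ `suN_abs_klDiv_state_restrict_div_sub_le_of_depth_dim` — per plaquette (`T(Λ) ≠ ∅`, `K ≥ 1`):
  `|KL(μ|_Λ ‖ Haar_Λ)/#T(Λ) − (−Nβ(N − u) − f(Nβ)/#planes(d))| ≤ 2Nβ·(C_N r^K + 3N·#{p ∈ T(Λ) : D_p < K}/#T(Λ))`;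
* ★★ `suN_klDiv_state_restrict_div_vanHove_tendsto_dim` — THE SPECIFIC RELATIVE ENTROPY OF THE INFINITE-VOLUME STATE EXISTS along every van
  Hove sequence with depth data, `= −Nβ(N − u) − f(Nβ)/#planes(d)`, for every `N ≥ 2`, `d ≥ 2` — HYPOTHESIS-FREE.
* ★★ `suN_toReal_klDiv_state_restrict_inner_law_le_dim` — INFORMATION GAIN ZERO, surface form, every `N ≥ 2`, `d ≥ 2`:
  `KL(μ|_Λ ‖ π_Λ^{Nβ,η}) ≤ 3Nβ·Σ_{p∈T(Λ)} min (2N) (C_N r^{⌊D_p⌋}) + 2N·Nβ·#∂T(Λ)` for EVERY boundary field `η` — HYPOTHESIS-FREE.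
WHAT THIS IS NOT: lattice strong coupling on the single-link window; relative entropy w.r.t. product Haar / inner Gibbs laws on finite regions;
nothing about the continuum limit or Clay. Everything here is proved. [folklore]
-/

noncomputable section

open MeasureTheory ProbabilityTheory InformationTheory Filter Topology Real Finset Set
open scoped NNReal ENNReal
open Literature.Probability.LatticeModels hiding configShift configShift_apply
open Literature.MathematicalPhysics.QuantumLattice
open Literature.MathematicalPhysics.QuantumFieldTheory (haarProbability)

namespace Summit.Ventures.YMGap.RobustBall

namespace BoundaryFreeEnergy

variable {d N : ℕ}

/-- **Boundary plaquettes are shallow, distance form**: if `D_p ≤ ‖y − z‖_∞` for every link `y` of `p` and every link `z ∉ Λ`, then every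
plaquette touching `Λ` with a link outside `Λ` has `D_p ≤ 0 < K` for `K ≥ 1`. [folklore] -/
theorem card_boundaryPlaquettes_le_card_shallow_dim (Λ : Finset (ZdEdge d)) (D : ZdPlaquette d → ℝ)
    (hD : ∀ p ∈ plaquettesTouching Λ, ∀ y ∈ plaquetteEdges p, ∀ z, z ∉ Λ → D p ≤ ‖y.1 - z.1‖) {K : ℕ} (hK : 1 ≤ K) :
    ((plaquettesTouching Λ).filter fun p => ¬plaquetteEdges p ⊆ Λ).card ≤ ((plaquettesTouching Λ).filter fun p => D p < K).card := by
  refine Finset.card_le_card (Finset.monotone_filter_right _ fun p hp hnot => ?_)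
  obtain ⟨x, hx, hxΛ⟩ := Finset.not_subset.1 hnot
  have h1 : D p ≤ 0 := by simpa using hD p hp x hx x hxΛ
  have hK' : (1 : ℝ) ≤ K := by exact_mod_cast hK
  linarith

section Window

variable [NeZero d] (hd : 2 ≤ d) (hN : 2 ≤ N) {β ρ : ℝ} (hβ0 : 0 ≤ β) (hβ : β ≤ 1 / (12 * ((d : ℝ) - 1))) (hβ' : β < 1 / (8 * (d : ℝ)))
  (hρ : 6 * ((d : ℝ) - 1) * β / (1 / 2 - β * (2 * ((d : ℝ) - 1))) ≤ ρ) (hρ1 : ρ < 1)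
include hd hN hβ0 hβ hβ' hρ hρ1

/-- ★★ **THE RELATIVE ENTROPY OF THE INFINITE-VOLUME STATE ON A FINITE REGION = VOLUME × DENSITY ± SURFACE, EVERY `N ≥ 2`, EVERY `d ≥ 2`**:
`|KL(μ|_Λ ‖ Haar_Λ) − #T(Λ)·(−Nβ(N − u) − f(Nβ)/#planes(d))| ≤ 2Nβ·Σ_{p∈T(Λ)} min (2N) (32N⁴√N·max(ρ,½)^{⌊D_p⌋}) + 2N·Nβ·#∂T(Λ)` — HYPOTHESIS-FREE.
[folklore] -/
theorem suN_abs_klDiv_state_restrict_sub_le_dim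
    {μ : Measure (LGConfig d (SUN N))} (hμ : μ ∈ ymGibbsMeasures (d := d) (fundamentalRep (Fin N)) (N * β))
    (Λ : Finset (ZdEdge d)) (D : ZdPlaquette d → ℝ)
    (hD : ∀ p ∈ plaquettesTouching Λ, ∀ y ∈ plaquetteEdges p, ∀ z, z ∉ Λ → D p ≤ ‖y.1 - z.1‖) :
    |(klDiv (μ.map (fun U (e : ↥Λ) => U e)) (Measure.pi fun _ : ↥Λ => haarProbability (SUN N))).toReal -
        (plaquettesTouching Λ).card *
          (-(N * β) * ((N : ℝ) - ∫ U, plaquetteObs (fundamentalRep (Fin N)) 0 0 1 U ∂μ) -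
            freeEnergyDensity d (fundamentalRep (Fin N)) (N * β) / (Fintype.card {q : Fin d × Fin d // q.1 < q.2} : ℝ))| ≤
      2 * (N * β) * ∑ p ∈ plaquettesTouching Λ, min (2 * (N : ℝ)) (32 * (N : ℝ) ^ 4 * Real.sqrt N * (max ρ (1 / 2)) ^ ⌊D p⌋₊) +
        2 * N * (N * β) * ((plaquettesTouching Λ).filter fun p => ¬plaquetteEdges p ⊆ Λ).card := by
  haveI : SecondCountableTopology (Matrix.specialUnitaryGroup (Fin N) ℂ) :=
    haveI : SecondCountableTopology (Matrix (Fin N) (Fin N) ℂ) := inferInstanceAs (SecondCountableTopology (Fin N → Fin N → ℂ))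
    Topology.IsEmbedding.subtypeVal.secondCountableTopology
  have hρc : Continuous (fundamentalRep (Fin N)) := continuous_fundamentalRep (Fin N)
  have hGibbs : IsGibbsMeasure (ymSpecification (d := d) (fundamentalRep (Fin N)) (N * β)) μ := hμ
  haveI := hGibbs.isProbabilityMeasure
  have hNβ0 : 0 ≤ (N : ℝ) * β := by positivity
  have hN0 : (0 : ℝ) ≤ N := by positivity
  set T := plaquettesTouching Λ with hTdef
  set S : ℝ := ∑ p ∈ T, min (2 * (N : ℝ)) (32 * (N : ℝ) ^ 4 * Real.sqrt N * (max ρ (1 / 2)) ^ ⌊D p⌋₊) with hS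
  set Dc : ℝ := ((T.filter fun p => ¬plaquetteEdges p ⊆ Λ).card : ℝ) with hDc
  set u := ∫ U, plaquetteObs (fundamentalRep (Fin N)) 0 0 1 U ∂μ with hu
  set f := freeEnergyDensity d (fundamentalRep (Fin N)) (N * β) with hf
  set np : ℝ := (Fintype.card {q : Fin d × Fin d // q.1 < q.2} : ℝ) with hnp
  set kl := (klDiv (μ.map (fun U (e : ↥Λ) => U e)) (Measure.pi fun _ : ↥Λ => haarProbability (SUN N))).toReal with hkl
  -- the one state is axis symmetric: all plaquette means agree
  have hβs : |β| < HessianSharp.sharpThresholdSU d := by rw [abs_of_nonneg hβ0]; exact hβ'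
  obtain ⟨ν, h1, h2, -, -⟩ := suN_wilson_oneState_symmetric_sharp hd hN hβs
  have hμν : μ = ν := by rw [h1] at hμ; exact Set.mem_singleton_iff.1 hμ
  have hνL : ν ∈ infiniteVolumeLimitPoints (d := d) (fundamentalRep (Fin N)) (N * β) := by rw [h2]; exact Set.mem_singleton _
  have hplane : ∀ p ∈ T, ∫ U, plaquetteObs (fundamentalRep (Fin N)) p.1 p.2.1.1 p.2.1.2 U ∂μ = u := fun p _ => by
    rw [hu, hμν]; exact PlaquettePositivity.integral_plaquetteObs_eq (fundamentalRep (Fin N)) hρc hd hνL p.1 (ne_of_lt p.2.2)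
  have hsum : ∑ p ∈ T, ((N : ℝ) - ∫ U, plaquetteObs (fundamentalRep (Fin N)) p.1 p.2.1.1 p.2.1.2 U ∂μ) = (T.card : ℝ) * (N - u) := by
    rw [Finset.sum_congr rfl fun p hp => by rw [hplane p hp], Finset.sum_const, nsmul_eq_mul]
  -- UPPER BOUND: Jensen under the DLR mixture + the every-`N` entropy form of «C-DS-I»
  have hup : kl ≤ -(N * β) * (T.card * (N - u)) - T.card / np * f + 2 * (N * β) * S := by
    refine (toReal_klDiv_map_restrict_le (fundamentalRep (Fin N)) hρc (N * β) Λ hμ fun η => ?_).2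
    have h := suN_abs_klDiv_inner_law_haar_sub_le_dim hd hN hβ0 hβ hβ' hρ hρ1 hμ Λ η D hD
    rw [← hTdef] at h
    rw [hsum, ← hS, ← hf, ← hnp, abs_le] at h
    linarith [h.2]
  -- LOWER BOUND: variational inequality at the boundary field `1`, «C-DS-I» every `N`, glued-restricted energy
  set η₀ : LGConfig d (SUN N) := fun _ => 1 with hη₀
  have hlow1 := neg_log_normaliser_sub_le_toReal_klDiv_map_restrict (fundamentalRep (Fin N)) hρc (N * β) Λ hμ η₀
  have hZ := suN_abs_log_normaliser_sub_freeEnergy_le hd hN hβ0 hβ hβ' hρ hρ1 Λ η₀ D hD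
  rw [← hTdef] at hZ
  rw [← hS, ← hf, ← hnp, abs_le] at hZ
  have hE : ∫ U, wilsonBoundaryAction (fundamentalRep (Fin N)) Λ (glueWith Λ (fun e : ↥Λ => U e) η₀) ∂μ ≤ T.card * (N - u) + 2 * N * Dc := by
    have hSc : Continuous (wilsonBoundaryAction (G := SUN N) (fundamentalRep (Fin N)) Λ) := continuous_wilsonBoundaryAction _ hρc Λ
    obtain ⟨C, hC⟩ := exists_bound_of_continuous hSc
    have hr : Measurable fun (U : LGConfig d (SUN N)) (e : ↥Λ) => U e := measurable_pi_lambda _ fun e => measurable_pi_apply _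
    have hi1 : Integrable (fun U : LGConfig d (SUN N) => wilsonBoundaryAction (fundamentalRep (Fin N)) Λ (glueWith Λ (fun e : ↥Λ => U e) η₀)) μ :=
      integrable_of_bound ((hSc.measurable.comp ((measurable_glueWith Λ η₀).comp hr)).aestronglyMeasurable) (C := C) fun U => hC _
    have hi2 : Integrable (fun U : LGConfig d (SUN N) => wilsonBoundaryAction (fundamentalRep (Fin N)) Λ U + 2 * N * Dc) μ :=
      (integrable_of_bound hSc.measurable.aestronglyMeasurable (C := C) fun U => hC U).add (integrable_const _)
    have hmono := integral_mono hi1 hi2 fun U => by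
      have h := suN_abs_action_glue_restrict_sub_le (N := N) Λ U η₀
      rw [← hTdef, abs_le] at h
      show wilsonBoundaryAction (fundamentalRep (Fin N)) Λ (glueWith Λ (fun e : ↥Λ => U e) η₀) ≤
        wilsonBoundaryAction (fundamentalRep (Fin N)) Λ U + 2 * N * Dc
      rw [hDc]
      linarith [h.2]
    rw [integral_add (integrable_of_bound hSc.measurable.aestronglyMeasurable (C := C) fun U => hC U) (integrable_const _), integral_const,
      smul_eq_mul, Measure.real, measure_univ, ENNReal.toReal_one, one_mul, suN_integral_wilsonBoundaryAction_eq_sum] at hmono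
    rw [← hTdef, hsum] at hmono
    exact hmono
  have hbE := mul_le_mul_of_nonneg_left hE hNβ0
  set X := ∫ U, wilsonBoundaryAction (fundamentalRep (Fin N)) Λ (glueWith Λ (fun e : ↥Λ => U e) η₀) ∂μ with hX
  set LZ := Real.log (∫ ζ, Real.exp (-(N * β) * wilsonBoundaryAction (fundamentalRep (Fin N)) Λ (glueWith Λ ζ η₀))
    ∂(Measure.pi fun _ : ↥Λ => haarProbability (SUN N))) with hLZ
  have hA : -LZ - (N : ℝ) * β * X ≤ kl := hlow1
  have hB : LZ - (T.card : ℝ) / np * f ≤ (N : ℝ) * β * S := hZ.2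
  have hC : (N : ℝ) * β * X ≤ (N : ℝ) * β * ((T.card : ℝ) * ((N : ℝ) - u) + 2 * (N : ℝ) * Dc) := hbE
  have hpos : 0 ≤ 2 * (N : ℝ) * ((N : ℝ) * β) * Dc := by positivity
  have e1 : (T.card : ℝ) / np * f = (T.card : ℝ) * (f / np) := by ring
  rw [abs_le]
  constructor
  · linarith [hA, hB, hC, e1]
  · linarith [hup, hpos, e1]

/-- ★★ **VAN HOVE FORM PER PLAQUETTE, EVERY `N ≥ 2`, EVERY `d ≥ 2`** (`T(Λ) ≠ ∅`, budget `K ≥ 1`):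
`|KL(μ|_Λ ‖ Haar_Λ)/#T(Λ) − (−Nβ(N − u) − f(Nβ)/#planes(d))| ≤ 2Nβ·(32N⁴√N·max(ρ,½)^K + 3N·#{p ∈ T(Λ) : D_p < K}/#T(Λ))` — HYPOTHESIS-FREE. [folklore] -/
theorem suN_abs_klDiv_state_restrict_div_sub_le_of_depth_dim
    {μ : Measure (LGConfig d (SUN N))} (hμ : μ ∈ ymGibbsMeasures (d := d) (fundamentalRep (Fin N)) (N * β))
    (Λ : Finset (ZdEdge d)) (hT : (plaquettesTouching Λ).Nonempty) (D : ZdPlaquette d → ℝ)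
    (hD : ∀ p ∈ plaquettesTouching Λ, ∀ y ∈ plaquetteEdges p, ∀ z, z ∉ Λ → D p ≤ ‖y.1 - z.1‖) {K : ℕ} (hK : 1 ≤ K) :
    |(klDiv (μ.map (fun U (e : ↥Λ) => U e)) (Measure.pi fun _ : ↥Λ => haarProbability (SUN N))).toReal / (plaquettesTouching Λ).card -
        (-(N * β) * ((N : ℝ) - ∫ U, plaquetteObs (fundamentalRep (Fin N)) 0 0 1 U ∂μ) -
          freeEnergyDensity d (fundamentalRep (Fin N)) (N * β) / (Fintype.card {q : Fin d × Fin d // q.1 < q.2} : ℝ))| ≤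
      2 * (N * β) * (32 * (N : ℝ) ^ 4 * Real.sqrt N * (max ρ (1 / 2)) ^ K +
        3 * N * ((plaquettesTouching Λ).filter fun p => D p < K).card / (plaquettesTouching Λ).card) := by
  set T := plaquettesTouching Λ with hTdef
  set r : ℝ := max ρ (1 / 2) with hr
  set C : ℝ := 32 * (N : ℝ) ^ 4 * Real.sqrt N with hC
  have hC0 : 0 ≤ C := by positivity
  have hr0 : 0 ≤ r := le_max_of_le_right (by norm_num)
  have hr1 : r ≤ 1 := max_le hρ1.le (by norm_num)
  have hN0 : (0 : ℝ) ≤ N := by positivity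
  have hNβ0 : 0 ≤ (N : ℝ) * β := by positivity
  have hTpos : (0 : ℝ) < (T.card : ℝ) := by exact_mod_cast Finset.card_pos.2 hT
  have hmain := suN_abs_klDiv_state_restrict_sub_le_dim hd hN hβ0 hβ hβ' hρ hρ1 hμ Λ D hD
  have hS := surface_sum_le_of_depth_dim hr0 hr1 hC0 (A := 2 * (N : ℝ)) T D K
  have hDc : (((T.filter fun p => ¬plaquetteEdges p ⊆ Λ).card : ℕ) : ℝ) ≤ ((T.filter fun p => D p < K).card : ℝ) := by
    exact_mod_cast card_boundaryPlaquettes_le_card_shallow_dim Λ D hD hK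
  set kl := (klDiv (μ.map (fun U (e : ↥Λ) => U e)) (Measure.pi fun _ : ↥Λ => haarProbability (SUN N))).toReal with hkl
  set h := -(N * β) * ((N : ℝ) - ∫ U, plaquetteObs (fundamentalRep (Fin N)) 0 0 1 U ∂μ) -
    freeEnergyDensity d (fundamentalRep (Fin N)) (N * β) / (Fintype.card {q : Fin d × Fin d // q.1 < q.2} : ℝ) with hh
  have key : ∀ (x t c : ℝ), 0 < t → x / t - c = (x - t * c) / t := fun x t c ht => by field_simp
  rw [key kl (T.card : ℝ) h hTpos, abs_div, abs_of_pos hTpos, div_le_iff₀ hTpos]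
  refine hmain.trans ?_
  have e : 2 * (N * β) * (C * r ^ K + 3 * N * ((T.filter fun p => D p < K).card : ℝ) / T.card) * T.card =
      2 * (N * β) * (C * r ^ K * T.card + 2 * N * (T.filter fun p => D p < K).card) +
        2 * N * (N * β) * (T.filter fun p => D p < K).card := by
    field_simp
    ring
  rw [e]
  have h2N : 0 ≤ 2 * N * ((N : ℝ) * β) := by positivity
  exact add_le_add (mul_le_mul_of_nonneg_left hS (by positivity)) (mul_le_mul_of_nonneg_left hDc h2N)

/-- ★★ **THE SPECIFIC RELATIVE ENTROPY OF THE INFINITE-VOLUME STATE EXISTS ALONG EVERY VAN HOVE SEQUENCE, EVERY `N ≥ 2`, EVERY `d ≥ 2`**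
(van Hove sequence with distance depth data `D_{n,p}`, shallow fractions `#{p ∈ T(Λ_n) : D_{n,p} < K}/#T(Λ_n) → 0` for every `K`):
`KL(μ|_{Λ_n} ‖ Haar_{Λ_n})/#T(Λ_n) → −Nβ(N − u) − f(Nβ)/#planes(d)` — HYPOTHESIS-FREE. [folklore] -/
theorem suN_klDiv_state_restrict_div_vanHove_tendsto_dim
    {μ : Measure (LGConfig d (SUN N))} (hμ : μ ∈ ymGibbsMeasures (d := d) (fundamentalRep (Fin N)) (N * β))
    (Λ : ℕ → Finset (ZdEdge d)) (hT : ∀ n, (plaquettesTouching (Λ n)).Nonempty) (D : ℕ → ZdPlaquette d → ℝ)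
    (hD : ∀ n, ∀ p ∈ plaquettesTouching (Λ n), ∀ y ∈ plaquetteEdges p, ∀ z, z ∉ Λ n → D n p ≤ ‖y.1 - z.1‖)
    (hvH : ∀ K : ℕ, Tendsto (fun n => ((((plaquettesTouching (Λ n)).filter fun p => D n p < K).card : ℝ)) /
      (plaquettesTouching (Λ n)).card) atTop (𝓝 0)) :
    Tendsto (fun n => (klDiv (μ.map (fun U (e : ↥(Λ n)) => U e)) (Measure.pi fun _ : ↥(Λ n) => haarProbability (SUN N))).toReal /
        (plaquettesTouching (Λ n)).card) atTop
      (𝓝 (-(N * β) * ((N : ℝ) - ∫ U, plaquetteObs (fundamentalRep (Fin N)) 0 0 1 U ∂μ) -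
        freeEnergyDensity d (fundamentalRep (Fin N)) (N * β) / (Fintype.card {q : Fin d × Fin d // q.1 < q.2} : ℝ))) := by
  rw [Metric.tendsto_atTop]
  intro ε hε
  have hr0 : (0 : ℝ) ≤ max ρ (1 / 2) := le_max_of_le_right (by norm_num)
  have hr1 : max ρ (1 / 2) < 1 := max_lt hρ1 (by norm_num)
  -- budget `K + 1 ≥ 1`
  obtain ⟨K, n₀, hKn⟩ := exists_budget_of_vanHove_pow hr0 hr1 (2 * (N * β)) (32 * (N : ℝ) ^ 4 * Real.sqrt N) (3 * N)
    (fun n K => ((((plaquettesTouching (Λ n)).filter fun p => D n p < ((K + 1 : ℕ) : ℝ)).card : ℝ)) / (plaquettesTouching (Λ n)).card)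
    (fun K => by simpa using hvH (K + 1)) (show (0 : ℝ) < ε / 2 by linarith)
  refine ⟨n₀, fun n hn => ?_⟩
  rw [Real.dist_eq]
  have hest := suN_abs_klDiv_state_restrict_div_sub_le_of_depth_dim hd hN hβ0 hβ hβ' hρ hρ1 hμ (Λ n) (hT n) (D n) (hD n)
    (K := K + 1) (by omega)
  have hpow : (max ρ (1 / 2)) ^ (K + 1) ≤ (max ρ (1 / 2)) ^ K := pow_le_pow_of_le_one hr0 hr1.le (Nat.le_succ K)
  have hNβ2 : 0 ≤ 2 * ((N : ℝ) * β) := by positivity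
  have hK' := hKn n hn
  have hcmp : 2 * (N * β) * (32 * (N : ℝ) ^ 4 * Real.sqrt N * (max ρ (1 / 2)) ^ (K + 1) +
      3 * N * ((((plaquettesTouching (Λ n)).filter fun p => D n p < ((K + 1 : ℕ) : ℝ)).card : ℝ)) / (plaquettesTouching (Λ n)).card) ≤
      2 * (N * β) * (32 * (N : ℝ) ^ 4 * Real.sqrt N * (max ρ (1 / 2)) ^ K +
        3 * N * (((((plaquettesTouching (Λ n)).filter fun p => D n p < ((K + 1 : ℕ) : ℝ)).card : ℝ)) / (plaquettesTouching (Λ n)).card)) := by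
    refine mul_le_mul_of_nonneg_left ?_ hNβ2
    have hC0 : (0 : ℝ) ≤ 32 * (N : ℝ) ^ 4 * Real.sqrt N := by positivity
    rw [mul_div_assoc]
    exact add_le_add_left (mul_le_mul_of_nonneg_left hpow hC0) _
  have hfin := hest.trans (hcmp.trans hK')
  linarith

/-- ★★ **INFORMATION GAIN ZERO, SURFACE FORM, EVERY `N ≥ 2`, EVERY `d ≥ 2`**: for EVERY boundary field `η`,
`KL(μ|_Λ ‖ π_Λ^{Nβ,η}) ≤ 3Nβ·Σ_{p∈T(Λ)} min (2N) (32N⁴√N·max(ρ,½)^{⌊D_p⌋}) + 2N·Nβ·#∂T(Λ)` — NO volume term; HYPOTHESIS-FREE. [folklore] -/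
theorem suN_toReal_klDiv_state_restrict_inner_law_le_dim
    {μ : Measure (LGConfig d (SUN N))} (hμ : μ ∈ ymGibbsMeasures (d := d) (fundamentalRep (Fin N)) (N * β))
    (Λ : Finset (ZdEdge d)) (η : LGConfig d (SUN N)) (D : ZdPlaquette d → ℝ)
    (hD : ∀ p ∈ plaquettesTouching Λ, ∀ y ∈ plaquetteEdges p, ∀ z, z ∉ Λ → D p ≤ ‖y.1 - z.1‖) :
    klDiv (μ.map (fun U (e : ↥Λ) => U e)) ((Measure.pi fun _ : ↥Λ => haarProbability (SUN N)).tilted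
        (fun ζ => -(N * β) * wilsonBoundaryAction (fundamentalRep (Fin N)) Λ (glueWith Λ ζ η))) ≠ ∞ ∧
    (klDiv (μ.map (fun U (e : ↥Λ) => U e)) ((Measure.pi fun _ : ↥Λ => haarProbability (SUN N)).tilted
        (fun ζ => -(N * β) * wilsonBoundaryAction (fundamentalRep (Fin N)) Λ (glueWith Λ ζ η)))).toReal ≤
      3 * (N * β) * ∑ p ∈ plaquettesTouching Λ, min (2 * (N : ℝ)) (32 * (N : ℝ) ^ 4 * Real.sqrt N * (max ρ (1 / 2)) ^ ⌊D p⌋₊) +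
        2 * N * (N * β) * ((plaquettesTouching Λ).filter fun p => ¬plaquetteEdges p ⊆ Λ).card := by
  haveI : SecondCountableTopology (Matrix.specialUnitaryGroup (Fin N) ℂ) :=
    haveI : SecondCountableTopology (Matrix (Fin N) (Fin N) ℂ) := inferInstanceAs (SecondCountableTopology (Fin N → Fin N → ℂ))
    Topology.IsEmbedding.subtypeVal.secondCountableTopology
  have hρc : Continuous (fundamentalRep (Fin N)) := continuous_fundamentalRep (Fin N)
  have hGibbs : IsGibbsMeasure (ymSpecification (d := d) (fundamentalRep (Fin N)) (N * β)) μ := hμ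
  haveI := hGibbs.isProbabilityMeasure
  have hNβ0 : 0 ≤ (N : ℝ) * β := by positivity
  have hr : Measurable fun (U : LGConfig d (SUN N)) (e : ↥Λ) => U e := measurable_pi_lambda _ fun e => measurable_pi_apply _
  haveI : IsProbabilityMeasure (μ.map (fun U (e : ↥Λ) => U e)) := Measure.isProbabilityMeasure_map hr.aemeasurable
  set H : Measure (↥Λ → SUN N) := Measure.pi fun _ : ↥Λ => haarProbability (SUN N) with hH
  haveI : IsProbabilityMeasure H := by rw [hH]; infer_instance
  set T := plaquettesTouching Λ with hTdef
  set S : ℝ := ∑ p ∈ T, min (2 * (N : ℝ)) (32 * (N : ℝ) ^ 4 * Real.sqrt N * (max ρ (1 / 2)) ^ ⌊D p⌋₊) with hS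
  set Dc : ℝ := ((T.filter fun p => ¬plaquetteEdges p ⊆ Λ).card : ℝ) with hDc
  set u := ∫ U, plaquetteObs (fundamentalRep (Fin N)) 0 0 1 U ∂μ with hu
  set f := freeEnergyDensity d (fundamentalRep (Fin N)) (N * β) with hf
  set np : ℝ := (Fintype.card {q : Fin d × Fin d // q.1 < q.2} : ℝ) with hnp
  obtain ⟨hac, hint⟩ := map_restrict_ac_integrable_llr (fundamentalRep (Fin N)) hρc (N * β) Λ hμ
  have hid := toReal_klDiv_inner_law_eq (fundamentalRep (Fin N)) hρc (N * β) Λ η (μ.map (fun U (e : ↥Λ) => U e)) hac hint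
  have hexpH : Integrable (fun ζ => Real.exp (-(N * β) * wilsonBoundaryAction (fundamentalRep (Fin N)) Λ (glueWith Λ ζ η))) H :=
    integrable_exp_neg_mul_action_glueWith (fundamentalRep (Fin N)) hρc (N * β) Λ η H
  have hSc : Continuous (wilsonBoundaryAction (G := SUN N) (fundamentalRep (Fin N)) Λ) := continuous_wilsonBoundaryAction _ hρc Λ
  obtain ⟨C, hC⟩ := exists_bound_of_continuous hSc
  have hfm : Measurable fun ζ : ↥Λ → SUN N => -(N * β) * wilsonBoundaryAction (fundamentalRep (Fin N)) Λ (glueWith Λ ζ η) :=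
    (hSc.measurable.comp (measurable_glueWith Λ η)).const_mul _
  have hne : klDiv (μ.map (fun U (e : ↥Λ) => U e))
      (H.tilted fun ζ => -(N * β) * wilsonBoundaryAction (fundamentalRep (Fin N)) Λ (glueWith Λ ζ η)) ≠ ∞ := by
    refine klDiv_ne_top (hac.trans (absolutelyContinuous_tilted hexpH)) ?_
    refine integrable_llr_tilted_right hac (integrable_of_bound hfm.aestronglyMeasurable (C := |N * β| * C) fun ζ => ?_) hint hexpH
    rw [abs_mul, abs_neg]; exact mul_le_mul_of_nonneg_left (hC _) (abs_nonneg _)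
  refine ⟨hne, ?_⟩
  -- axis symmetry
  have hβs : |β| < HessianSharp.sharpThresholdSU d := by rw [abs_of_nonneg hβ0]; exact hβ'
  obtain ⟨ν, h1, h2, -, -⟩ := suN_wilson_oneState_symmetric_sharp hd hN hβs
  have hμν : μ = ν := by rw [h1] at hμ; exact Set.mem_singleton_iff.1 hμ
  have hνL : ν ∈ infiniteVolumeLimitPoints (d := d) (fundamentalRep (Fin N)) (N * β) := by rw [h2]; exact Set.mem_singleton _
  have hplane : ∀ p ∈ T, ∫ U, plaquetteObs (fundamentalRep (Fin N)) p.1 p.2.1.1 p.2.1.2 U ∂μ = u := fun p _ => by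
    rw [hu, hμν]; exact PlaquettePositivity.integral_plaquetteObs_eq (fundamentalRep (Fin N)) hρc hd hνL p.1 (ne_of_lt p.2.2)
  have hsum : ∑ p ∈ T, ((N : ℝ) - ∫ U, plaquetteObs (fundamentalRep (Fin N)) p.1 p.2.1.1 p.2.1.2 U ∂μ) = (T.card : ℝ) * (N - u) := by
    rw [Finset.sum_congr rfl fun p hp => by rw [hplane p hp], Finset.sum_const, nsmul_eq_mul]
  -- (1) Jensen + every-N entropy form
  have hup : (klDiv (μ.map (fun U (e : ↥Λ) => U e)) H).toReal ≤ -(N * β) * (T.card * (N - u)) - T.card / np * f + 2 * (N * β) * S := by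
    refine (toReal_klDiv_map_restrict_le (fundamentalRep (Fin N)) hρc (N * β) Λ hμ fun η' => ?_).2
    have h := suN_abs_klDiv_inner_law_haar_sub_le_dim hd hN hβ0 hβ hβ' hρ hρ1 hμ Λ η' D hD
    rw [← hTdef] at h
    rw [hsum, ← hS, ← hf, ← hnp, abs_le] at h
    linarith [h.2]
  -- (2) energy against `η`
  have hE : ∫ ζ, wilsonBoundaryAction (fundamentalRep (Fin N)) Λ (glueWith Λ ζ η) ∂(μ.map (fun U (e : ↥Λ) => U e)) ≤
      T.card * (N - u) + 2 * N * Dc := by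
    have hmap : ∫ ζ, wilsonBoundaryAction (fundamentalRep (Fin N)) Λ (glueWith Λ ζ η) ∂(μ.map (fun U (e : ↥Λ) => U e)) =
        ∫ U, wilsonBoundaryAction (fundamentalRep (Fin N)) Λ (glueWith Λ (fun e : ↥Λ => U e) η) ∂μ :=
      integral_map hr.aemeasurable ((hSc.measurable.comp (measurable_glueWith Λ η)).aestronglyMeasurable)
    rw [hmap]
    have hi1 : Integrable (fun U : LGConfig d (SUN N) => wilsonBoundaryAction (fundamentalRep (Fin N)) Λ (glueWith Λ (fun e : ↥Λ => U e) η)) μ :=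
      integrable_of_bound ((hSc.measurable.comp ((measurable_glueWith Λ η).comp hr)).aestronglyMeasurable) (C := C) fun U => hC _
    have hi2 : Integrable (fun U : LGConfig d (SUN N) => wilsonBoundaryAction (fundamentalRep (Fin N)) Λ U + 2 * N * Dc) μ :=
      (integrable_of_bound hSc.measurable.aestronglyMeasurable (C := C) fun U => hC U).add (integrable_const _)
    have hmono := integral_mono hi1 hi2 fun U => by
      have h := suN_abs_action_glue_restrict_sub_le (N := N) Λ U η
      rw [← hTdef, abs_le] at h
      show wilsonBoundaryAction (fundamentalRep (Fin N)) Λ (glueWith Λ (fun e : ↥Λ => U e) η) ≤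
        wilsonBoundaryAction (fundamentalRep (Fin N)) Λ U + 2 * N * Dc
      rw [hDc]
      linarith [h.2]
    rw [integral_add (integrable_of_bound hSc.measurable.aestronglyMeasurable (C := C) fun U => hC U) (integrable_const _), integral_const,
      smul_eq_mul, Measure.real, measure_univ, ENNReal.toReal_one, one_mul, suN_integral_wilsonBoundaryAction_eq_sum] at hmono
    rw [← hTdef, hsum] at hmono
    exact hmono
  -- (3) «C-DS-I» every N for log Z(η)
  have hZ := suN_abs_log_normaliser_sub_freeEnergy_le hd hN hβ0 hβ hβ' hρ hρ1 Λ η D hD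
  rw [← hTdef] at hZ
  rw [← hS, ← hf, ← hnp, abs_le] at hZ
  have hbE := mul_le_mul_of_nonneg_left hE hNβ0
  set X := ∫ ζ, wilsonBoundaryAction (fundamentalRep (Fin N)) Λ (glueWith Λ ζ η) ∂(μ.map (fun U (e : ↥Λ) => U e)) with hX
  set LZ := Real.log (∫ ζ, Real.exp (-(N * β) * wilsonBoundaryAction (fundamentalRep (Fin N)) Λ (glueWith Λ ζ η))
    ∂(Measure.pi fun _ : ↥Λ => haarProbability (SUN N))) with hLZ
  have hidR : (klDiv (μ.map (fun U (e : ↥Λ) => U e))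
      (H.tilted fun ζ => -(N * β) * wilsonBoundaryAction (fundamentalRep (Fin N)) Λ (glueWith Λ ζ η))).toReal =
      (klDiv (μ.map (fun U (e : ↥Λ) => U e)) H).toReal + (N : ℝ) * β * X + LZ := hid
  have hB : LZ - (T.card : ℝ) / np * f ≤ (N : ℝ) * β * S := hZ.2
  have hC' : (N : ℝ) * β * X ≤ (N : ℝ) * β * ((T.card : ℝ) * ((N : ℝ) - u) + 2 * (N : ℝ) * Dc) := hbE
  have e1 : (T.card : ℝ) / np * f = (T.card : ℝ) * (f / np) := by ring
  rw [hidR]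
  linarith [hup, hB, hC', e1]

end Window

end BoundaryFreeEnergy

end Summit.Ventures.YMGap.RobustBall

end
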